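import Summits.CriticalPhenomena.PercolationContinuityZ3.Theorems.PercNearOneGluingNoHeavyQuantGatedSliceMixLawRegimeBKink1
import Summits.CriticalPhenomena.PercolationContinuityZ3.Theorems.PercNearOneGluingNoHeavyQuantGatedSliceMixLawRegimeBKink2
import HarnessLib

/-!
# QUANT lane R8, T-DEC, leg (III), blob case — `LawDec.GatedSliceMixLaw'` in REGIME B: **CELL B-G IS CLOSED** (`h + a ≥ j+1`, `k₂ ≥ j+1`,
# `d = k₁ + a` a `t`-low, `h` a mid, `W_h ∉ D`): the polynomial inequality (⋆) PROVED for `k₁ < ag(1−z)` (first kink), the second kink for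
# `k₁ ≥ ag(1−z)` — `MixLawRegimeB` restricted to cell B-G is a theorem

builds on p205010 (kernel theorem, internal audit signed; external expert review pending)

Support file (`--supports stmt-CriticalPhenomena-4575`), QUANT lane lead seat (gen 32), rung R8 of `run/shared/lean/prim/quant/LADDER.md`.
Memo `run/shared/lean/prim/quant/prim-quant-lead-g32/FOR-PROVERS-MIXLAW-KINKS.md` §5–§7.  Theorems only, standard axioms, no sorries.
Companions: `…RegimeBTools`, `…RegimeBKink1` (first kink modulo (⋆)), `…RegimeBKink2` (second kink under the usage bound for `k₁`).

THE DICHOTOMY.  `k₁ ≥ ag(1−z) = t − S` ⟹ `k₁ + h > t` and the usage bound `usage(k₁,h)(h−S) ≤ t − k₁` (`usage_mul_sub_le_light_or`, second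
alternative) ⟹ the SECOND kink certifies (`gatedSliceMixLaw_regimeB_kink2`).  `k₁ < ag(1−z)` ⟹ (⋆) holds (this file) ⟹ the FIRST kink certifies
(`gatedSliceMixLaw_regimeB_kink1`).  PROOF OF (⋆) (`mixLawB_star_of_small_k1`): (⋆) is affine in `ξ = y(h−S) ∈ (0, S(1−y) − y]` (the upper bound is
`k₂ ≥ h + 1`, `y k₂ ≤ S`); at `ξ = 0` its slack is `(t−d)(1−y)Sg² ≥ 0`; at `ξ = S(1−y) − y` it is `V₁ = yg(gS−k₁) + P((1−y)S(1−g) − y)` with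
`P = (1−g)(ag−k₁) + ag²z ≥ 0` and `gS ≥ k₁`; writing `V₁ = y·B + P(1−y)(1−g)S`, `B = g(gS−k₁) − P`: if `B ≥ 0` done, else `y ≤ g` gives
`V₁ ≥ gB + P(1−g)²S`, increasing in `S ≥ S₀ = 2k₁ + a(2 − g(1−z))` (the `t`-low condition), and `V₂(S₀) ≥ 0` (`mixLawB_V2_nonneg`) by concavity in
`k₁ ∈ [0, ag(1−z)]` with endpoint values `≥ a·g·Φ₀(g, g(1−z))` and `≥ a·g·Φ₁(g, z)` (`a ≥ 1`), where `Φ₀ = (1−g)²w² + (1−g)(4g−3)w + (4g²−5g+2) ≥ 0`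
on `0 ≤ w ≤ g ≤ 1` (complete the square for `g ≥ 1/4`, monotone to `w = g` otherwise) and `Φ₁ ≥ 0` (concave in `z`, endpoints `g²+g³`, `4g²−5g+2`).
Exact census beforehand (lead g32, cellB2g/h: 2.6·10⁶ instances, `M ≤ 130`): 0 failures of (⋆) on the small-`k₁` part; arm-3 g64's large-`M`
failures of the first kink (INBOX 03:32Z) all have `k₁ ≥ ag(1−z)` and are the second kink's.

* `LawDec.mixLawB_phi0_nonneg`, `LawDec.mixLawB_phi1_nonneg`, `LawDec.mixLawB_V2_nonneg` — the elementary polynomial facts.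
* `LawDec.mixLawB_star_of_small_k1` — (⋆) for `k₁ ≤ ag(1−z)`.
* `LawDec.g_lt_one_of_not_decAtT_weakMidLaw` — regime B: `W_h ∉ D ⟹ g < 1`.
* **`LawDec.gatedSliceMixLaw_regimeBG`** — the conclusion of `GatedSliceMixLaw'` (= `MixLawRegimeB`'s) on cell B-G: regime B, `k₂ ≥ j+1`,
  `2(k₁+a) < t`, `k₁ + a ≤ j`, `1 ≤ a`, `W_h ∉ D`.
What is left of `MixLawRegimeB`: cell B-M (`k₂ ≤ j` a mid) and the `ℓ = k₁ + a` absorber classes (census-2 g61).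

[this work]; exchange architecture: prim-quant-stmt g30; flow form / criterion E / usage closed forms: prim-quant-stmt g22–g27, arm-1 g39, lead g21
(this lane); cell map: arm-3 g63–g64, lead g31–g32.  Nothing here is cited as a published result.  The gluing rows served
[cite: KozmaNitzan2024, Conjecture 3 (p. 15)]; product measure [cite: Grimmett1999, §1.3 p. 10].
-/

noncomputable section

namespace Summit.CriticalPhenomena.PercolationContinuityZ3.Theorems

namespace Quant

open Finset

/-- the two-point law `{lo, hi; g}` (as in `…QuantLawDEC`) -/
local notation3 "TP[" lo ", " hi ", " g ", " h "]" =>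
  (g : ℝ) * (if (h : ℕ) = (hi : ℕ) then (1 : ℝ) else 0) + (1 - (g : ℝ)) * (if (h : ℕ) = (lo : ℕ) then (1 : ℝ) else 0)

namespace LawDec

/-! ### The polynomial facts behind (⋆) -/

/-- `Φ₀(g,w) = (1−g)²w² + (1−g)(4g−3)w + (4g²−5g+2) ≥ 0` for `0 ≤ w ≤ g ≤ 1`. [this work] -/
theorem mixLawB_phi0_nonneg (g w : ℝ) (hg1 : g ≤ 1) (hw0 : 0 ≤ w) (hwg : w ≤ g) :
    0 ≤ (1 - g) ^ 2 * w ^ 2 + (1 - g) * (4 * g - 3) * w + (4 * g ^ 2 - 5 * g + 2) := by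
  by_cases hq : 1 / 4 ≤ g
  · -- complete the square: = ((1−g)w + (4g−3)/2)² + (4g−1)/4
    have e : (1 - g) ^ 2 * w ^ 2 + (1 - g) * (4 * g - 3) * w + (4 * g ^ 2 - 5 * g + 2)
        = ((1 - g) * w + (4 * g - 3) / 2) ^ 2 + (4 * g - 1) / 4 := by ring
    rw [e]; nlinarith [sq_nonneg ((1 - g) * w + (4 * g - 3) / 2)]
  · have hg4 : g < 1 / 4 := not_le.1 hq
    -- decreasing in w on [0, g]: value ≥ value at w = g, which is 2 − 8g + 12g² − 6g³ + g⁴ ≥ 0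
    have e : (1 - g) ^ 2 * w ^ 2 + (1 - g) * (4 * g - 3) * w + (4 * g ^ 2 - 5 * g + 2)
        = (2 - 8 * g + 12 * g ^ 2 - 6 * g ^ 3 + g ^ 4)
          + (w - g) * (1 - g) * ((1 - g) * (w + g) + (4 * g - 3)) := by ring
    rw [e]
    have hg0 : 0 ≤ g := le_trans hw0 hwg
    have h1 : 0 ≤ 2 - 8 * g + 12 * g ^ 2 - 6 * g ^ 3 + g ^ 4 := by nlinarith [sq_nonneg g, mul_nonneg hg0 (sq_nonneg g)]
    have h2 : (1 - g) * (w + g) + (4 * g - 3) ≤ 0 := by nlinarith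
    have h3 : 0 ≤ (w - g) * (1 - g) * ((1 - g) * (w + g) + (4 * g - 3)) := by
      have : 0 ≤ (g - w) * (1 - g) := mul_nonneg (by linarith) (by linarith)
      nlinarith
    linarith

/-- `Φ₁(g,z) = g²(2 + g − gz) − g²(1−z) − gz + z(1−g)²(2 + g − gz) ≥ 0` for `0 ≤ g ≤ 1`, `0 ≤ z ≤ 1` (concave in `z`, nonnegative at
`z = 0` and `z = 1`). [this work] -/
theorem mixLawB_phi1_nonneg (g z : ℝ) (hg0 : 0 ≤ g) (hz0 : 0 ≤ z) (hz1 : z ≤ 1) :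
    0 ≤ g ^ 2 * (2 + g - g * z) - g ^ 2 * (1 - z) - g * z + z * (1 - g) ^ 2 * (2 + g - g * z) := by
  -- value = (1−z)·Φ₁(0) + z·Φ₁(1) + g(1−g)² z(1−z), Φ₁(0) = g² + g³, Φ₁(1) = 4g² − 5g + 2
  have e : g ^ 2 * (2 + g - g * z) - g ^ 2 * (1 - z) - g * z + z * (1 - g) ^ 2 * (2 + g - g * z)
      = (1 - z) * (g ^ 2 + g ^ 3) + z * (4 * g ^ 2 - 5 * g + 2) + g * (1 - g) ^ 2 * (z * (1 - z)) := by ring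
  rw [e]
  have h1 : 0 ≤ g ^ 2 + g ^ 3 := by positivity
  have h2 : 0 ≤ 4 * g ^ 2 - 5 * g + 2 := by nlinarith [sq_nonneg (g - 5 / 8)]
  have h3 : 0 ≤ g * (1 - g) ^ 2 * (z * (1 - z)) := mul_nonneg (mul_nonneg hg0 (sq_nonneg _)) (mul_nonneg hz0 (by linarith))
  nlinarith [mul_nonneg (show (0:ℝ) ≤ 1 - z by linarith) h1, mul_nonneg hz0 h2]

/-- **`V₂(S₀) ≥ 0`**: with `w = g(1−z)`, `S₀ = 2k₁ + a(2 − w)`, `P = ag(1 − w) − (1−g)k₁`: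
`g(g²S₀ − g k₁ − P) + P(1−g)²S₀ ≥ 0` for `1 ≤ a`, `0 ≤ k₁ ≤ a·w`, `0 ≤ g ≤ 1`, `0 ≤ z ≤ 1` (concave in `k₁`; endpoints `a·g·Φ₀`, `a·g·Φ₁`). [this work] -/
theorem mixLawB_V2_nonneg (g z a k₁ : ℝ) (hg0 : 0 ≤ g) (hg1 : g ≤ 1) (hz0 : 0 ≤ z) (hz1 : z ≤ 1) (ha1 : 1 ≤ a)
    (hk0 : 0 ≤ k₁) (hk1 : k₁ ≤ a * (g * (1 - z))) :
    0 ≤ g * (g ^ 2 * (2 * k₁ + a * (2 - g * (1 - z))) - g * k₁ - (a * g * (1 - g * (1 - z)) - (1 - g) * k₁))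
      + (a * g * (1 - g * (1 - z)) - (1 - g) * k₁) * (1 - g) ^ 2 * (2 * k₁ + a * (2 - g * (1 - z))) := by
  set w : ℝ := g * (1 - z) with hw
  have hw0 : 0 ≤ w := mul_nonneg hg0 (by linarith)
  have hwg : w ≤ g := by rw [hw]; nlinarith
  have ha0 : 0 ≤ a := by linarith
  set K : ℝ := a * w with hK
  have hK0 : 0 ≤ K := mul_nonneg ha0 hw0
  -- the function of k₁
  set f : ℝ → ℝ := fun k => g * (g ^ 2 * (2 * k + a * (2 - w)) - g * k - (a * g * (1 - w) - (1 - g) * k))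
      + (a * g * (1 - w) - (1 - g) * k) * (1 - g) ^ 2 * (2 * k + a * (2 - w)) with hf
  have goal_eq : g * (g ^ 2 * (2 * k₁ + a * (2 - g * (1 - z))) - g * k₁ - (a * g * (1 - g * (1 - z)) - (1 - g) * k₁))
      + (a * g * (1 - g * (1 - z)) - (1 - g) * k₁) * (1 - g) ^ 2 * (2 * k₁ + a * (2 - g * (1 - z))) = f k₁ := by
    simp only [hf, hw]
  rw [goal_eq]
  -- endpoint 0: f 0 = a g²[g(2−w) − (1−w)] + a² g (1−w)(1−g)²(2−w) ≥ a g Φ₀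
  have hf0 : 0 ≤ f 0 := by
    have e0 : f 0 = a * g ^ 2 * (g * (2 - w) - (1 - w)) + a ^ 2 * g * (1 - w) * (1 - g) ^ 2 * (2 - w) := by
      simp only [hf]; ring
    have hΦ := mixLawB_phi0_nonneg g w hg1 hw0 hwg
    have ephi : (1 - g) ^ 2 * w ^ 2 + (1 - g) * (4 * g - 3) * w + (4 * g ^ 2 - 5 * g + 2)
        = g * (g * (2 - w) - (1 - w)) + (1 - w) * (1 - g) ^ 2 * (2 - w) := by ring
    have hT : 0 ≤ g * (1 - w) * (1 - g) ^ 2 * (2 - w) :=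
      mul_nonneg (mul_nonneg (mul_nonneg hg0 (by linarith)) (sq_nonneg _)) (by linarith)
    -- a² T ≥ a T
    have haa : a * (g * (1 - w) * (1 - g) ^ 2 * (2 - w)) ≤ a ^ 2 * (g * (1 - w) * (1 - g) ^ 2 * (2 - w)) := by
      have : a ≤ a ^ 2 := by nlinarith
      exact mul_le_mul_of_nonneg_right this hT
    rw [e0]
    have key : a * g * ((1 - g) ^ 2 * w ^ 2 + (1 - g) * (4 * g - 3) * w + (4 * g ^ 2 - 5 * g + 2))
        = a * g ^ 2 * (g * (2 - w) - (1 - w)) + a * (g * (1 - w) * (1 - g) ^ 2 * (2 - w)) := by rw [ephi]; ring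
    have hag : 0 ≤ a * g * ((1 - g) ^ 2 * w ^ 2 + (1 - g) * (4 * g - 3) * w + (4 * g ^ 2 - 5 * g + 2)) :=
      mul_nonneg (mul_nonneg ha0 hg0) hΦ
    nlinarith [key, hag, haa]
  -- endpoint K: f K ≥ a g Φ₁
  have hfK : 0 ≤ f K := by
    have eK : f K = a * (g ^ 3 * (2 + w) - g ^ 2 * w - g ^ 2 * z) + a ^ 2 * g * z * (1 - g) ^ 2 * (2 + w) := by
      simp only [hf, hK, hw]; ring
    have hΦ := mixLawB_phi1_nonneg g z hg0 hz0 hz1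
    have ephi : g ^ 2 * (2 + g - g * z) - g ^ 2 * (1 - z) - g * z + z * (1 - g) ^ 2 * (2 + g - g * z)
        = (g ^ 2 * (2 + w) - g * w - g * z) + z * (1 - g) ^ 2 * (2 + w) := by simp only [hw]; ring
    have hT : 0 ≤ g * z * (1 - g) ^ 2 * (2 + w) := mul_nonneg (mul_nonneg (mul_nonneg hg0 hz0) (sq_nonneg _)) (by linarith)
    have haa : a * (g * z * (1 - g) ^ 2 * (2 + w)) ≤ a ^ 2 * (g * z * (1 - g) ^ 2 * (2 + w)) := by
      have : a ≤ a ^ 2 := by nlinarith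
      exact mul_le_mul_of_nonneg_right this hT
    rw [eK]
    have key : a * g * (g ^ 2 * (2 + g - g * z) - g ^ 2 * (1 - z) - g * z + z * (1 - g) ^ 2 * (2 + g - g * z))
        = a * (g ^ 3 * (2 + w) - g ^ 2 * w - g ^ 2 * z) + a * (g * z * (1 - g) ^ 2 * (2 + w)) := by rw [ephi]; ring
    have hag : 0 ≤ a * g * (g ^ 2 * (2 + g - g * z) - g ^ 2 * (1 - z) - g * z + z * (1 - g) ^ 2 * (2 + g - g * z)) :=
      mul_nonneg (mul_nonneg ha0 hg0) hΦ
    nlinarith [key, hag, haa]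
  -- concavity in k₁: f(k₁) ≥ (1−λ) f 0 + λ f K with λ = k₁/K (or K = 0)
  by_cases hKz : K = 0
  · have hk : k₁ = 0 := le_antisymm (by rw [hK] at hKz; linarith [hk1, hKz]) hk0
    rw [hk]; exact hf0
  · have hKp : 0 < K := lt_of_le_of_ne hK0 (Ne.symm hKz)
    set lam : ℝ := k₁ / K with hlam
    have hl0 : 0 ≤ lam := div_nonneg hk0 hKp.le
    have hl1 : lam ≤ 1 := by rw [hlam, div_le_one hKp, hK]; exact hk1
    have hkl : k₁ = lam * K := by rw [hlam]; field_simp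
    -- f(λK) − (1−λ)f(0) − λ f(K) = 2(1−g)³ K² λ(1−λ) ≥ 0
    have conc : f (lam * K) - ((1 - lam) * f 0 + lam * f K) = 2 * (1 - g) ^ 3 * K ^ 2 * (lam * (1 - lam)) := by
      simp only [hf]; ring
    have hpos : 0 ≤ 2 * (1 - g) ^ 3 * K ^ 2 * (lam * (1 - lam)) := by
      have : 0 ≤ (1 - g) ^ 3 := pow_nonneg (by linarith) 3
      exact mul_nonneg (mul_nonneg (mul_nonneg (by norm_num) this) (sq_nonneg K)) (mul_nonneg hl0 (by linarith))
    rw [hkl]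
    nlinarith [conc, hpos, mul_nonneg (show (0:ℝ) ≤ 1 - lam by linarith) hf0, mul_nonneg hl0 hfK]

set_option maxHeartbeats 400000 in
/-- **(⋆) ON THE SMALL-`k₁` PART OF CELL B-G**: for `0 < y ≤ (1−z)g`, `0 ≤ z ≤ 1`, `g < 1`, `1 ≤ a`, `0 ≤ k₁ ≤ ag(1−z)`,
`2k₁ + a(2 − g(1−z)) < S < h`, `y(h+1) ≤ S`:
`(S + ag(1−z) − k₁ − a)·g·(y(h−S) − (1−y)Sg) ≤ y(1−g)(h−S)(gS − k₁)`.
PROOF: affine in `ξ = y(h−S) ∈ (0, S(1−y) − y]`; at `ξ = 0` the slack is `(t−d)(1−y)Sg² ≥ 0`, at `ξ = S(1−y) − y` it is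
`V₁ = yg(gS−k₁) + P((1−y)S(1−g) − y)`, `P = (1−g)(ag−k₁) + ag²z ≥ 0`; `V₁ = y·B + P(1−y)(1−g)S` with `B = g(gS−k₁) − P`; if `B < 0`,
`y ≤ g` gives `V₁ ≥ gB + P(1−g)²S`, increasing in `S`, and at `S₀ = 2k₁ + a(2−g(1−z))` this is `mixLawB_V2_nonneg`. [this work] -/
theorem mixLawB_star_of_small_k1 (y z g S h a k₁ : ℝ) (hy0 : 0 < y) (hyg : y ≤ (1 - z) * g) (hz0 : 0 ≤ z) (hz1 : z ≤ 1)
    (hg1 : g < 1) (ha1 : 1 ≤ a) (hk0 : 0 ≤ k₁) (hk1 : k₁ ≤ a * g * (1 - z))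
    (hS0 : 2 * k₁ + a * (2 - g * (1 - z)) < S) (hSh : S < h) (hyh : y * (h + 1) ≤ S) :
    (S + a * g * (1 - z) - k₁ - a) * g * (y * (h - S) - (1 - y) * S * g) ≤ y * (1 - g) * (h - S) * (g * S - k₁) := by
  have h1z : 0 ≤ 1 - z := by linarith
  have hg0 : 0 < g := by
    by_contra hle
    have : (1 - z) * g ≤ 0 := mul_nonpos_of_nonneg_of_nonpos h1z (not_lt.1 hle)
    linarith
  have ha0 : 0 ≤ a := by linarith
  have hyg' : y ≤ g := by nlinarith
  have hy1 : y < 1 := by linarith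
  have h1y : 0 < 1 - y := by linarith
  have h1g : 0 < 1 - g := by linarith
  have hw1 : g * (1 - z) ≤ 1 := by nlinarith
  have hS1 : 0 < S := by nlinarith [mul_nonneg ha0 (show (0:ℝ) ≤ 2 - g * (1 - z) by linarith)]
  set τ : ℝ := S + a * g * (1 - z) - k₁ - a with hτ
  have hτ0 : 0 < τ := by rw [hτ]; nlinarith
  set ξ : ℝ := y * (h - S) with hξ
  have hξ0 : 0 < ξ := mul_pos hy0 (by linarith)
  set σ : ℝ := S * (1 - y) - y with hσ
  have hξσ : ξ ≤ σ := by rw [hξ, hσ]; nlinarith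
  have hσ0 : 0 < σ := lt_of_lt_of_le hξ0 hξσ
  -- P, B and the endpoint value V₁
  set P : ℝ := (1 - g) * (a * g - k₁) + a * g ^ 2 * z with hP
  have hagk : k₁ ≤ a * g := by nlinarith [mul_nonneg (mul_nonneg ha0 hg0.le) hz0]
  have hP0 : 0 ≤ P := by
    rw [hP]; exact add_nonneg (mul_nonneg h1g.le (by linarith)) (mul_nonneg (mul_nonneg ha0 (sq_nonneg g)) hz0)
  have hgS : k₁ ≤ g * S := by nlinarith
  -- V₁ ≥ 0
  have hV1 : 0 ≤ y * g * (g * S - k₁) + P * ((1 - y) * S * (1 - g) - y) := by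
    have eV : y * g * (g * S - k₁) + P * ((1 - y) * S * (1 - g) - y)
        = y * (g * (g * S - k₁) - P) + P * (1 - y) * (1 - g) * S := by ring
    rw [eV]
    by_cases hB : 0 ≤ g * (g * S - k₁) - P
    · exact add_nonneg (mul_nonneg hy0.le hB) (mul_nonneg (mul_nonneg (mul_nonneg hP0 h1y.le) h1g.le) hS1.le)
    · have hBn : g * (g * S - k₁) - P < 0 := not_le.1 hB
      -- y·B ≥ g·B and (1−y) ≥ (1−g)
      have h1 : g * (g * (g * S - k₁) - P) ≤ y * (g * (g * S - k₁) - P) := by nlinarith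
      have h2 : P * (1 - g) * (1 - g) * S ≤ P * (1 - y) * (1 - g) * S := by
        have : P * (1 - g) * S * (1 - g) ≤ P * (1 - g) * S * (1 - y) :=
          mul_le_mul_of_nonneg_left (by linarith) (mul_nonneg (mul_nonneg hP0 h1g.le) hS1.le)
        linarith
      -- V₂(S) ≥ V₂(S₀) ≥ 0
      have hV2S0 := mixLawB_V2_nonneg g z a k₁ hg0.le hg1.le hz0 hz1 ha1 hk0 (by nlinarith)
      have eP : a * g * (1 - g * (1 - z)) - (1 - g) * k₁ = P := by rw [hP]; ring
      rw [eP] at hV2S0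
      have hmono : g * (g ^ 2 * (2 * k₁ + a * (2 - g * (1 - z))) - g * k₁ - P) + P * (1 - g) ^ 2 * (2 * k₁ + a * (2 - g * (1 - z)))
          ≤ g * (g ^ 2 * S - g * k₁ - P) + P * (1 - g) ^ 2 * S := by
        have hc : 0 ≤ g ^ 3 + P * (1 - g) ^ 2 := add_nonneg (pow_nonneg hg0.le 3) (mul_nonneg hP0 (sq_nonneg _))
        nlinarith [mul_le_mul_of_nonneg_left hS0.le hc]
      have e3 : g * (g ^ 2 * S - g * k₁ - P) + P * (1 - g) ^ 2 * S = g * (g * (g * S - k₁) - P) + P * (1 - g) * (1 - g) * S := by ring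
      linarith
  -- F(ξ) ≥ 0 by affinity between ξ = 0 and ξ = σ
  have eF : y * (1 - g) * (h - S) * (g * S - k₁) - τ * g * (y * (h - S) - (1 - y) * S * g)
      = ξ * ((1 - g) * (g * S - k₁) - τ * g) + τ * (1 - y) * S * g ^ 2 := by rw [hξ]; ring
  have eFσ : σ * ((1 - g) * (g * S - k₁) - τ * g) + τ * (1 - y) * S * g ^ 2
      = y * g * (g * S - k₁) + P * ((1 - y) * S * (1 - g) - y) := by rw [hσ, hτ, hP]; ring
  have hF0 : 0 ≤ τ * (1 - y) * S * g ^ 2 := mul_nonneg (mul_nonneg (mul_nonneg hτ0.le h1y.le) hS1.le) (sq_nonneg g)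
  -- ξ·slope + c ≥ 0 from (σ·slope + c ≥ 0, c ≥ 0, 0 ≤ ξ ≤ σ)
  have key : 0 ≤ ξ * ((1 - g) * (g * S - k₁) - τ * g) + τ * (1 - y) * S * g ^ 2 := by
    by_cases hs : 0 ≤ (1 - g) * (g * S - k₁) - τ * g
    · exact add_nonneg (mul_nonneg hξ0.le hs) hF0
    · have hsn := not_le.1 hs
      have : σ * ((1 - g) * (g * S - k₁) - τ * g) ≤ ξ * ((1 - g) * (g * S - k₁) - τ * g) := by nlinarith
      rw [eFσ] at *
      linarith
  linarith [eF, key]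

/-! ### `W_h ∉ D ⟹ g < 1` in regime B -/

/-- in regime B (`h` a mid, `h + a ≥ j+1`, `h ≤ M`, `y·M ≤ S`), `¬DECAtT … (weakMidLaw S g h a)` forces `g < 1`. [this work] -/
theorem g_lt_one_of_not_decAtT_weakMidLaw (y z g S : ℝ) (a j M h : ℕ) (hy0 : 0 < y) (hy1 : y < 1) (hg0 : 0 ≤ g) (hg1 : g ≤ 1)
    (hS0 : 0 < S) (hta : y * (M : ℝ) ≤ S) (hSh : S < (h : ℝ)) (hhj : h ≤ j) (hhM : h ≤ M) (hhaG : j + 1 ≤ h + a)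
    (hhmid : S + (a : ℝ) * g * (1 - z) ≤ 2 * (h : ℝ))
    (hW : ¬ DECAtT y (S + (a : ℝ) * g * (1 - z)) j (M + a) (weakMidLaw S g h a)) : g < 1 := by
  by_contra hge
  have hgeq : g = 1 := le_antisymm hg1 (not_lt.1 hge)
  have hh0 : (0 : ℝ) < h := lt_trans hS0 hSh
  have h1y : 0 < 1 - y := by linarith
  have hyh : y * (h : ℝ) ≤ S := le_trans (mul_le_mul_of_nonneg_left (by exact_mod_cast hhM) hy0.le) hta
  apply hW
  refine decAtT_weakMidLaw_of_giant y z g S a j M h hy0 hy1 hg0 hg1 hS0.le hSh hhj hhM hhaG hhmid ?_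
  rw [hgeq, mul_one, div_mul_eq_mul_div, div_le_iff₀ h1y]
  have hys : y ≤ S / h := by rw [le_div_iff₀ hh0]; exact hyh
  nlinarith

/-! ### Cell B-G closed -/

/-- **`GatedSliceMixLaw'` ON CELL B-G** (regime B: `h + a ≥ j+1`; `k₂ ≥ j+1`; `d = k₁ + a` a `t`-low with `d ≤ j`; `h` a mid; `1 ≤ a`;
`W_h ∉ D`): the conclusion of `GatedSliceMixLaw'`, by the dichotomy `k₁ < ag(1−z)` (first kink, (⋆) proved) / `k₁ ≥ ag(1−z)` (second kink).
[this work] -/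
theorem gatedSliceMixLaw_regimeBG (y z g S lam : ℝ) (a j M h k₁ k₂ : ℕ)
    (hy0 : 0 < y) (hy1 : y < 1) (hz0 : 0 ≤ z) (hz1 : z < 1) (hg1 : g ≤ 1) (hyg : y ≤ (1 - z) * g) (ha1 : 1 ≤ a)
    (hS0 : 0 < S) (hta : y * (M : ℝ) ≤ S) (hhj : h ≤ j) (hhM : h ≤ M) (hSh : S < (h : ℝ))
    (hW : ¬ DECAtT y (S + (a : ℝ) * g * (1 - z)) j (M + a) (weakMidLaw S g h a))
    (hk : k₁ ≤ k₂) (hk₂M : k₂ ≤ M) (hlam0 : 0 ≤ lam) (hlam1 : lam ≤ 1)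
    (hmean : (1 - z) * ((k₁ : ℝ) + ((k₂ : ℝ) - k₁) * lam) = S)
    (hdlow : 2 * ((k₁ + a : ℕ) : ℝ) < S + (a : ℝ) * g * (1 - z)) (hdj : k₁ + a ≤ j)
    (hk₂G : j + 1 ≤ k₂) (hhaG : j + 1 ≤ h + a) (hhmid : S + (a : ℝ) * g * (1 - z) ≤ 2 * (h : ℝ)) :
    ∃ θ : ℝ, 0 ≤ θ ∧ θ < 1 ∧
      DECAtT y (S + (a : ℝ) * g * (1 - z)) j (M + a)
        (fun p => θ * weakMidLaw S g h a p
          + (1 - θ) * (z * (if p = 0 then (1 : ℝ) else 0) + (1 - z) * slice (fun q => TP[k₁, k₂, lam, q]) a g p)) := by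
  have h1z : 0 < 1 - z := by linarith
  have hg0 : 0 < g := by nlinarith
  have hg1' : g < 1 := g_lt_one_of_not_decAtT_weakMidLaw y z g S a j M h hy0 hy1 hg0.le hg1 hS0 hta hSh hhj hhM hhaG hhmid hW
  have ha0 : (0 : ℝ) ≤ a := Nat.cast_nonneg a
  have ha1' : (1 : ℝ) ≤ a := by exact_mod_cast ha1
  have hk₁0 : (0 : ℝ) ≤ k₁ := Nat.cast_nonneg k₁
  have hdcast : ((k₁ + a : ℕ) : ℝ) = (k₁ : ℝ) + a := by push_cast; ring
  have hk₁j : k₁ ≤ j := by omega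
  by_cases hsmall : (k₁ : ℝ) < (a : ℝ) * g * (1 - z)
  · -- first kink, (⋆) proved
    have hyh1 : y * ((h : ℝ) + 1) ≤ S := by
      have : (h : ℝ) + 1 ≤ k₂ := by
        have : h + 1 ≤ k₂ := by omega
        exact_mod_cast this
      have hyk₂ : y * (k₂ : ℝ) ≤ S := le_trans (mul_le_mul_of_nonneg_left (by exact_mod_cast hk₂M) hy0.le) hta
      nlinarith
    have hstar := mixLawB_star_of_small_k1 y z g S h a k₁ hy0 hyg hz0 hz1.le hg1' ha1' hk₁0 hsmall.le
      (by rw [hdcast] at hdlow; linarith) hSh hyh1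
    exact gatedSliceMixLaw_regimeB_kink1 y z g S lam a j M h k₁ k₂ hy0 hy1 hz0 hz1 hg1 hyg hS0 hta hhj hhM hSh hW hk hk₂M
      hlam0 hlam1 hmean hdlow hdj hk₁j hk₂G hhaG hhmid hstar
  · -- second kink: k₁ ≥ ag(1−z) = t − S
    have hbig : (a : ℝ) * g * (1 - z) ≤ k₁ := not_lt.1 hsmall
    have hcomp₁ : S + (a : ℝ) * g * (1 - z) < (k₁ : ℝ) + h := by linarith
    exact gatedSliceMixLaw_regimeB_kink2 y z g S lam a j M h k₁ k₂ hy0 hy1 hz0 hz1 hg1' hyg hS0 hta hhj hhM hSh hk hk₂M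
      hlam0 hlam1 hmean hdlow hdj hk₂G hhaG hhmid hcomp₁ (Or.inr (by linarith))

end LawDec

end Quant

end Summit.CriticalPhenomena.PercolationContinuityZ3.Theorems
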